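import Literature.NumberTheory.Automorphic.SymplecticSatakeTransformDuality
import Literature.NumberTheory.Automorphic.SatakeTransformIwasawaCentral
import Literature.NumberTheory.Automorphic.SymplecticSimilitudeHeckeTriangularProducts
import Literature.NumberTheory.Automorphic.SymplecticSimilitudeIwasawaCartan
import HarnessLib

/-!
# The `w₀`-symmetry of the Satake transforms of `GSp_{2n}`: for every `T ∈ ℋ(GSp_{2n}(K), GSp_{2n}(𝒪); R)` the coefficients
# of `x^{(α, c)}` and `x^{(c·1 - α, c)}` in `𝒮(T)` agree up to the modulus index (Cartier Thm. 4.1 for the longest Weyl element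
# of `GSp_{2n}`, which acts on `X_*(S) = ℤⁿ × ℤ` by `(α, c) ↦ (c·1 - α, c)`; Andrianov–Zhuravlev Ch. 3 §3.3; Laumon (4.1.4)–(4.1.6))

Topic `NumberTheory/Automorphic`; namespaces `Literature.NumberTheory.Automorphic.IsIwasawaExponent` (§0, abstract: the
duality twisted by a CENTRAL element) and `Literature.NumberTheory.Automorphic.SymplecticCartan` (lane `lit-hodgefound`, Track 2
foundations; seat `lit-hodgefound-p11`, generation 44, row g44-#6).  THEOREMS ONLY: no definition, no named fact, no instance,
no notation.  The `GSp_{2n}` instance of the abstract duality `SatakeTransformDuality` (g44-#1) for the Iwasawa datum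
`(B(K), GSp(J, 𝒪), (a, c))` of `SymplecticSimilitudeSatakeTransform` (`isIwasawaExponent_similitude`, `Λ = ℤⁿ × ℤ`).

## The mathematics

`G = GSp(J, K)`, `K₀ = GSp(J, 𝒪)`, `P = B(K)` (block triangular for the Borel order), `(a, c)(g) = (ord p_{inl i, inl i}; ord r(g))`,
`K_P = B(K) ∩ K₀ = B(𝒪)`, torus representatives `t(m, a) = diag(ϖ^m ϖ^{a}; ϖ^{-a})` with `(a, c)(t(m, a)) = (m + a, m)`; the
elements `t(2k, -k·1) = ϖ^k · 1` are CENTRAL with exponent `(k·1, 2k)`.  In contrast with `Sp_{2n}` the double cosets of `GSp_{2n}`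
are not self-inverse; instead (§2), from the Cartan decomposition `g ∈ K₀ t(m, a) K₀` and `J t(-m, -a) J⁻¹ = t(-2m, m·1) t(m, a)`:

  `K₀ g⁻¹ K₀ = K₀ (ϖ^{-m}·1) g K₀`,  i.e.  `T_{g⁻¹} = T_{ϖ^{-m}·1} T_g`,  `m = c(g)`   (`doubleCosetOperator_inv_similitude`),

so (§0, abstract: `N(z g, ν) = N(g, ν - a z)` for `z ∈ P` central) the duality of g44-#1 becomes, uniformly in `g` and
`λ = (α, c) ∈ ℤⁿ × ℤ`, with **`w₀(α, c) = (c·1 - α, c)`** (the longest Weyl element of `GSp_{2n}` on `X_*(S)`) and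
`t_λ = t(c, α - c·1)` (`(a, c)(t_λ) = λ`):

  `#{γ ∈ K₀gK₀/K₀ : (a,c)(γ) = λ} · [t_λK_Pt_λ⁻¹ : K_P ∩ t_λK_Pt_λ⁻¹] = #{γ ∈ K₀gK₀/K₀ : (a,c)(γ) = w₀λ} · [K_P : K_P ∩ t_λK_Pt_λ⁻¹]`

(`card_filter_similitudeIwasawaExp_mul_relIndex_eq`; both sides vanish unless `c = c(g)`), and, `R`-linearly (§4), for every
commutative ring `R`, every `T ∈ ℋ(GSp(J, K), GSp(J, 𝒪); R)`, every weight `w` and every `λ`: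

  `𝒮_w(T)_λ · w(w₀λ) · [t_λK_Pt_λ⁻¹ : K_P ∩ t_λK_Pt_λ⁻¹] = 𝒮_w(T)_{w₀λ} · w(λ) · [K_P : K_P ∩ t_λK_Pt_λ⁻¹]`

(`coeff_satakeTransform_mul_relIndex_eq_similitude`; `w = 1`: `coeff_satakeTransform_one_mul_relIndex_eq_similitude`; Andrianov–
Zhuravlev's normalisation `q^{⟨ρ, α⟩}`: `coeff_similitudeSatakeTransform_mul_relIndex_eq`).  For `λ` ANTIDOMINANT (`α` monotone,
`αᵢ + αⱼ ≤ c`) `t_λ` contracts `K_P` and **`𝒮_1(T)_λ = [K_P : t_λK_Pt_λ⁻¹] · 𝒮_1(T)_{w₀λ}`**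
(`coeff_satakeTransform_one_eq_relIndex_mul_similitude`).  The relative unimodularity hypothesis of g44-#1 holds for `B(K) ⊂ GSp`
(§3, contracting element `t(0, (i - n)_i)`: `exists_subgroup_relIndex_ne_zero_similitude`).  This is the `w₀`-part of A–Z
Thm. 3.30 / Cartier Thm. 4.1 («the image of `Ω` is the `W`-invariants») for `GSp_{2n}` over any `R`, modulus kept as an index.

## What is formalised (theorems only)

* §0 (abstract) `card_filter_orbit_central_mul` (`N(zg, ν) = N(g, ν - a z)`, `z ∈ P` central),
  **`card_filter_mul_relIndex_eq_of_orbit_inv_eq`** (the duality when `K g⁻¹ K = K z g K`).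
* §1 `coe_coe_similitudeTorusElt_eq_diagonal_zpow`, `similitudeTorusElt_inv`, `coe_coe_conj_similitudeTorusElt_apply`,
  `similitudeTorusElt_pow`, `coe_coe_similitudeTorusElt_two_mul_neg` (`t(2k,-k·1) = ϖ^k·1`), `similitudeTorusElt_two_mul_neg_central`,
  `similitudeIwasawaExp_similitudeTorusElt_two_mul_neg`, `similitudeIwasawaExp_similitudeTorusElt_sub` (`(a,c)(t(c, α-c·1)) = (α,c)`),
  `similitudeTorusElt_inv_eq_conj_J` (`t(m,a)⁻¹ = J⁻¹ t(-2m,m·1) t(m,a) J`).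
* §2 **`orbit_inv_eq_orbit_central_mul_similitude`**, **`doubleCosetOperator_inv_similitude`** (`T_{g⁻¹} = T_{ϖ^{-m}·1} T_g`),
  `snd_similitudeIwasawaExp_out_eq_of_mem_orbit`.
* §3 `v_apply_eq_one_of_similitudeIwasawaExp_eq_zero`, `v_conj_similitudeTorusElt_apply_le_one`,
  `conj_mem_symplecticSimilitudeInt_of_monotone`, **`conjAct_smul_inf_le_similitude`**,
  **`exists_conj_pow_mem_symplecticSimilitudeInt`**, **`exists_subgroup_relIndex_ne_zero_similitude`**.
* §4 **`card_filter_similitudeIwasawaExp_mul_relIndex_eq`**, **`coeff_satakeTransform_mul_relIndex_eq_similitude`**,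
  `coeff_satakeTransform_one_mul_relIndex_eq_similitude`, **`coeff_similitudeSatakeTransform_mul_relIndex_eq`**,
  **`coeff_satakeTransform_one_eq_relIndex_mul_similitude`**.

## References
* [CartierCorvallis1979] P. Cartier, *Representations of 𝔭-adic groups: a survey*, PSPM 33.1 (1979), §I.3, §IV (4.2), Thm. 4.1.
* [AndrianovZhuravlev1995] A. N. Andrianov, V. G. Zhuravlev, *Modular Forms and Hecke Operators*, Transl. Math. Monogr. 145,
  Ch. 3 §3 Lemma 3.6, Thm. 3.7, §3.3 (3.44)–(3.49), Thm. 3.30.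
* [Laumon1995] G. Laumon, *Cohomology of Drinfeld Modular Varieties I*, CUP, (4.1.4)–(4.1.6).
* [ShimuraIATAF1971] G. Shimura, *Introduction to the Arithmetic Theory of Automorphic Functions* (1971), Prop. 3.17.
* [BruhatTits1972] F. Bruhat, J. Tits, *Groupes réductifs sur un corps local I*, Publ. Math. IHÉS 41 (1972), (4.4.3), (4.4.4).
* [Kottwitz1992] R. E. Kottwitz, *Points on some Shimura varieties over finite fields*, J. AMS 5 (1992), §7 Lemma 7.4.
-/

noncomputable section

open scoped Valued WithZero Pointwise MatrixGroups
open Matrix MonoidAlgebra Representation Finset MulAction ConjAct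

/-! ## §0 Abstract: the duality twisted by a central element -/

namespace Literature.NumberTheory.Automorphic.IsIwasawaExponent

variable {G : Type*} [Group G] {Λ : Type*} [AddCommGroup Λ] {P K : Subgroup G} {a : G → Λ}

/-- **`N(z g, ν) = N(g, ν - a z)` for `z ∈ P` central**: left multiplication by `z` is a bijection from the left cosets in
`K g K` onto those in `K z g K = z K g K`, shifting the exponent by `a z`. [cite: ShimuraIATAF1971, Prop. 3.17]
[cite: CartierCorvallis1979, §IV (4.2)] -/
theorem card_filter_orbit_central_mul (h : IsIwasawaExponent P K a) [IsHeckeTriple (⊤ : Submonoid G) K K] {z : G}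
    (hz : ∀ x : G, x * z = z * x) (hzP : z ∈ P) (g : G) (ν : Λ) [DecidablePred fun α : G ⧸ K => a α.out = ν]
    [DecidablePred fun α : G ⧸ K => a α.out = ν - a z] :
    ((finite_orbit_quotient K (z * g)).toFinset.filter (fun α => a α.out = ν)).card =
      ((finite_orbit_quotient K g).toFinset.filter (fun α => a α.out = ν - a z)).card := by
  classical
  have himg : (finite_orbit_quotient K (z * g)).toFinset = (finite_orbit_quotient K g).toFinset.image (z • ·) := by
    ext γ
    rw [Set.Finite.mem_toFinset, Finset.mem_image, heckeAlgebra.orbit_mk_central_mul K hz g, Set.mem_image]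
    simp only [Set.Finite.mem_toFinset]
  rw [himg, Finset.filter_image, Finset.card_image_of_injective _ (MulAction.injective z)]
  congr 1
  refine Finset.filter_congr fun γ _ => ?_
  have hout : a (z • γ).out = a z + a γ.out := by
    conv_lhs => rw [← QuotientGroup.out_eq' γ]
    rw [MulAction.Quotient.smul_mk, smul_eq_mul, h.apply_out_coe, h.apply_mul_of_mem_left hzP]
  simp only [hout]
  constructor
  · intro h1; rw [← h1, add_sub_cancel_left]
  · intro h1; rw [h1, add_sub_cancel]

/-- **The duality twisted by a central element**: if `K g⁻¹ K = K z g K` with `z ∈ P` central, then for every `t ∈ P`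
`N(g, a t) · [tK_Pt⁻¹ : K_P ∩ tK_Pt⁻¹] = N(g, -a z - a t) · [K_P : K_P ∩ tK_Pt⁻¹]` (`K_P = P ∩ K`).
[cite: CartierCorvallis1979, §IV (4.2), Thm. 4.1] [cite: ShimuraIATAF1971, Prop. 3.17] -/
theorem card_filter_mul_relIndex_eq_of_orbit_inv_eq (h : IsIwasawaExponent P K a) [IsHeckeTriple (⊤ : Submonoid G) K K]
    (hU : ∀ y ∈ P, a y = 0 → ∃ V : Subgroup G, y ∈ V ∧ P ⊓ K ≤ V ∧ (P ⊓ K).relIndex V ≠ 0)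
    {g z : G} (hz : ∀ x : G, x * z = z * x) (hzP : z ∈ P) (hinv : orbit K ((g⁻¹ : G) : G ⧸ K) = orbit K ((z * g : G) : G ⧸ K))
    {t : G} (ht : t ∈ P) [DecidablePred fun α : G ⧸ K => a α.out = a t]
    [DecidablePred fun α : G ⧸ K => a α.out = -a z - a t] :
    ((finite_orbit_quotient K g).toFinset.filter (fun α => a α.out = a t)).card * (P ⊓ K).relIndex (toConjAct t • (P ⊓ K)) =
      ((finite_orbit_quotient K g).toFinset.filter (fun α => a α.out = -a z - a t)).card *
        (toConjAct t • (P ⊓ K)).relIndex (P ⊓ K) := by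
  classical
  have key := h.card_filter_mul_relIndex_eq hU g ht
  have horb : (finite_orbit_quotient K g⁻¹).toFinset = (finite_orbit_quotient K (z * g)).toFinset := by
    ext γ
    rw [Set.Finite.mem_toFinset, Set.Finite.mem_toFinset, hinv]
  rw [horb, h.card_filter_orbit_central_mul hz hzP g (-a t)] at key
  have e : -a t - a z = -a z - a t := by abel
  simp only [e] at key
  convert key using 2

end Literature.NumberTheory.Automorphic.IsIwasawaExponent

namespace Literature.NumberTheory.Automorphic.SymplecticCartan

open Literature.NumberTheory.Automorphic.CartanUnique Literature.NumberTheory.Automorphic.HermitianLattice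

variable {K : Type*} [Field K] [Valued K ℤᵐ⁰] {ϖ : K} {n : ℕ}

/-! ## §1 Torus representatives `t(m, a)`: matrices, inverses, conjugation, the central `t(2k, -k·1) = ϖ^k · 1` -/

omit [Valued K ℤᵐ⁰] in
/-- The matrix of `t(m, a)` is `diagonal (ϖ^{ε})`, `ε = (m + a; -a)`. [cite: AndrianovZhuravlev1995, Ch. 3 §3 Lemma 3.6] -/
theorem coe_coe_similitudeTorusElt_eq_diagonal_zpow (hϖ0 : ϖ ≠ 0) (m : ℤ) (a : Fin n → ℤ) :
    (((similitudeTorusElt hϖ0 m a : symplecticSimilitudeGroup (Fin n) K) : GL (Fin n ⊕ Fin n) K) :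
        Matrix (Fin n ⊕ Fin n) (Fin n ⊕ Fin n) K) =
      Matrix.diagonal fun s => ϖ ^ Sum.elim (fun i => m + a i) (fun i => -a i) s := by
  rw [coe_coe_similitudeTorusElt]
  congr 1
  funext s
  rcases s with i | i
  · rw [Sum.elim_inl, Sum.elim_inl, zpow_add₀ hϖ0]
  · rw [Sum.elim_inr, Sum.elim_inr]

omit [Valued K ℤᵐ⁰] in
/-- **`t(m, a)⁻¹ = t(-m, -a)`.** [cite: AndrianovZhuravlev1995, Ch. 3 §3 Lemma 3.6] -/
theorem similitudeTorusElt_inv (hϖ0 : ϖ ≠ 0) (m : ℤ) (a : Fin n → ℤ) :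
    (similitudeTorusElt hϖ0 m a : symplecticSimilitudeGroup (Fin n) K)⁻¹ = similitudeTorusElt hϖ0 (-m) (-a) :=
  inv_eq_of_mul_eq_one_right (by rw [similitudeTorusElt_mul, add_neg_cancel, add_neg_cancel, similitudeTorusElt_zero])

omit [Valued K ℤᵐ⁰] in
/-- **Entries of a conjugate by `t(m, a)`**: `(t x t⁻¹)_{s s'} = ϖ^{ε s - ε s'} x_{s s'}`, `ε = (m + a; -a)`.
[cite: BruhatTits1972, (4.4.4) (ii)] -/
theorem coe_coe_conj_similitudeTorusElt_apply (hϖ0 : ϖ ≠ 0) (m : ℤ) (a : Fin n → ℤ) (x : symplecticSimilitudeGroup (Fin n) K)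
    (s s' : Fin n ⊕ Fin n) :
    (((similitudeTorusElt hϖ0 m a * x * (similitudeTorusElt hϖ0 m a)⁻¹ : symplecticSimilitudeGroup (Fin n) K) :
        GL (Fin n ⊕ Fin n) K) : Matrix (Fin n ⊕ Fin n) (Fin n ⊕ Fin n) K) s s' =
      ϖ ^ (Sum.elim (fun i => m + a i) (fun i => -a i) s - Sum.elim (fun i => m + a i) (fun i => -a i) s') *
        ((x : GL (Fin n ⊕ Fin n) K) : Matrix (Fin n ⊕ Fin n) (Fin n ⊕ Fin n) K) s s' := by
  rw [similitudeTorusElt_inv, Subgroup.coe_mul, Subgroup.coe_mul, Units.val_mul, Units.val_mul,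
    coe_coe_similitudeTorusElt_eq_diagonal_zpow, coe_coe_similitudeTorusElt_eq_diagonal_zpow, Matrix.mul_diagonal,
    Matrix.diagonal_mul, zpow_sub₀ hϖ0, div_eq_mul_inv, ← _root_.zpow_neg]
  have e : Sum.elim (fun i => -m + (-a) i) (fun i => -(-a) i) s' = -Sum.elim (fun i => m + a i) (fun i => -a i) s' := by
    rcases s' with j | j
    · simp only [Sum.elim_inl, Pi.neg_apply]; ring
    · simp only [Sum.elim_inr, Pi.neg_apply]
  rw [e]
  ring

omit [Valued K ℤᵐ⁰] in
/-- Powers of torus representatives: `t(m, a)^k = t(km, ka)`. [cite: AndrianovZhuravlev1995, Ch. 3 §3 Lemma 3.6] -/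
theorem similitudeTorusElt_pow (hϖ0 : ϖ ≠ 0) (m : ℤ) (a : Fin n → ℤ) (k : ℕ) :
    (similitudeTorusElt hϖ0 m a : symplecticSimilitudeGroup (Fin n) K) ^ k = similitudeTorusElt hϖ0 ((k : ℤ) * m) ((k : ℤ) • a) := by
  induction k with
  | zero =>
    rw [pow_zero, Nat.cast_zero, zero_mul, zero_smul, similitudeTorusElt_zero]
  | succ k ih =>
    rw [pow_succ, ih, similitudeTorusElt_mul, Nat.cast_succ, add_mul, one_mul, add_smul, one_smul]

omit [Valued K ℤᵐ⁰] in
/-- **`t(2k, -k·1) = ϖ^k · 1`.** [cite: AndrianovZhuravlev1995, Ch. 3 §3.3] -/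
theorem coe_coe_similitudeTorusElt_two_mul_neg (hϖ0 : ϖ ≠ 0) (k : ℤ) :
    (((similitudeTorusElt hϖ0 (2 * k) (fun _ : Fin n => -k) : symplecticSimilitudeGroup (Fin n) K) : GL (Fin n ⊕ Fin n) K) :
        Matrix (Fin n ⊕ Fin n) (Fin n ⊕ Fin n) K) = (ϖ ^ k) • (1 : Matrix (Fin n ⊕ Fin n) (Fin n ⊕ Fin n) K) := by
  rw [coe_coe_similitudeTorusElt_eq_diagonal_zpow, Matrix.smul_one_eq_diagonal]
  congr 1
  funext s
  rcases s with i | i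
  · rw [Sum.elim_inl]; congr 1; ring
  · rw [Sum.elim_inr, neg_neg]

omit [Valued K ℤᵐ⁰] in
/-- **`ϖ^k · 1 = t(2k, -k·1)` is central in `GSp(J, K)`.** [cite: AndrianovZhuravlev1995, Ch. 3 §3.3] [cite: ShimuraIATAF1971, Prop. 3.17] -/
theorem similitudeTorusElt_two_mul_neg_central (hϖ0 : ϖ ≠ 0) (k : ℤ) (x : symplecticSimilitudeGroup (Fin n) K) :
    x * similitudeTorusElt hϖ0 (2 * k) (fun _ : Fin n => -k) = similitudeTorusElt hϖ0 (2 * k) (fun _ : Fin n => -k) * x := by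
  refine Subtype.ext (Units.ext ?_)
  rw [Subgroup.coe_mul, Subgroup.coe_mul, Units.val_mul, Units.val_mul, coe_coe_similitudeTorusElt_two_mul_neg,
    Matrix.mul_smul, Matrix.mul_one, Matrix.smul_mul, Matrix.one_mul]

/-- **`(a, c)(ϖ^k · 1) = (k·1, 2k)`.** [cite: AndrianovZhuravlev1995, Ch. 3 §3 Lemma 3.6] -/
theorem similitudeIwasawaExp_similitudeTorusElt_two_mul_neg [NeZero n] (hϖ : Valued.v ϖ = WithZero.exp (-1 : ℤ)) (k : ℤ) :
    similitudeIwasawaExp hϖ (similitudeTorusElt (uniformizer_ne_zero hϖ) (2 * k) (fun _ : Fin n => -k) :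
        symplecticSimilitudeGroup (Fin n) K) = (fun _ => k, 2 * k) := by
  rw [similitudeIwasawaExp_similitudeTorusElt]
  refine Prod.ext (funext fun i => ?_) rfl
  simp only
  ring

/-- `(a, c)(t(c, α - c·1)) = (α, c)`: every `λ ∈ ℤⁿ × ℤ` is the exponent of a torus representative.
[cite: AndrianovZhuravlev1995, Ch. 3 §3 Lemma 3.6] -/
theorem similitudeIwasawaExp_similitudeTorusElt_sub [NeZero n] (hϖ : Valued.v ϖ = WithZero.exp (-1 : ℤ)) (α : Fin n → ℤ)
    (c : ℤ) :
    similitudeIwasawaExp hϖ (similitudeTorusElt (uniformizer_ne_zero hϖ) c (fun i => α i - c) :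
      symplecticSimilitudeGroup (Fin n) K) = (α, c) := by
  rw [similitudeIwasawaExp_similitudeTorusElt]
  refine Prod.ext (funext fun i => ?_) rfl
  simp only
  ring

omit [Valued K ℤᵐ⁰] in
/-- **`t(m, a)⁻¹ = J⁻¹ · t(-2m, m·1) t(m, a) · J`**: the inverse of a torus representative is conjugate under the long Weyl
element `J ∈ Sp(J, 𝒪)` to its central twist by `ϖ^{-m}·1` (`J t(-m,-a) J⁻¹ = t(-m, a + m·1)`).
[cite: AndrianovZhuravlev1995, Ch. 3 §3 Lemma 3.6, proof of Thm. 3.7] -/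
theorem similitudeTorusElt_inv_eq_conj_J (hϖ0 : ϖ ≠ 0) (m : ℤ) (a : Fin n → ℤ) :
    (similitudeTorusElt hϖ0 m a : symplecticSimilitudeGroup (Fin n) K)⁻¹ =
      (ofSymplectic ⟨Matrix.J (Fin n) K, SymplecticGroup.J_mem (Fin n) K⟩)⁻¹ *
        (similitudeTorusElt hϖ0 (2 * (-m)) (fun _ : Fin n => -(-m)) * similitudeTorusElt hϖ0 m a) *
          ofSymplectic ⟨Matrix.J (Fin n) K, SymplecticGroup.J_mem (Fin n) K⟩ := by
  have hJ := J_conj_similitudeTorusElt (K := K) hϖ0 (-m) (-a)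
  have e : (similitudeTorusElt hϖ0 (2 * (-m)) (fun _ : Fin n => -(-m)) * similitudeTorusElt hϖ0 m a :
      symplecticSimilitudeGroup (Fin n) K) = similitudeTorusElt hϖ0 (-m) (fun i => -(-a) i - (-m)) := by
    rw [similitudeTorusElt_mul]
    congr 1
    · ring
    · funext i; simp only [Pi.add_apply, Pi.neg_apply]; ring
  rw [e, ← hJ, similitudeTorusElt_inv]
  group

/-! ## §2 Inversion of double cosets of `(GSp(J, K), GSp(J, 𝒪))`: `K₀ g⁻¹ K₀ = K₀ (ϖ^{-m}·1) g K₀` -/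

section Inversion

variable [NeZero n]

omit [NeZero n] in
/-- **`K₀ g⁻¹ K₀ = K₀ (ϖ^{-m}·1) g K₀`** for `g ∈ K₀ t(m, a) K₀`: from `t(m,a) = A g B` (`A, B ∈ K₀`),
`g⁻¹ = B t(m,a)⁻¹ A = (ϖ^{-m}·1) · (B J⁻¹ A) g (B J A)`. [cite: AndrianovZhuravlev1995, Ch. 3 §3, proof of Thm. 3.7]
[cite: ShimuraIATAF1971, Prop. 3.17] -/
theorem orbit_inv_eq_orbit_central_mul_similitude (hϖ : Valued.v ϖ = WithZero.exp (-1 : ℤ))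
    (g : symplecticSimilitudeGroup (Fin n) K) {m : ℤ} {a : Fin n → ℤ}
    (hg : ((similitudeTorusElt (uniformizer_ne_zero hϖ) m a : symplecticSimilitudeGroup (Fin n) K) :
        symplecticSimilitudeGroup (Fin n) K ⧸ symplecticSimilitudeInt (Fin n) K) ∈
      MulAction.orbit (symplecticSimilitudeInt (Fin n) K)
        (g : symplecticSimilitudeGroup (Fin n) K ⧸ symplecticSimilitudeInt (Fin n) K)) :
    MulAction.orbit (symplecticSimilitudeInt (Fin n) K)
        ((g⁻¹ : symplecticSimilitudeGroup (Fin n) K) : symplecticSimilitudeGroup (Fin n) K ⧸ symplecticSimilitudeInt (Fin n) K) =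
      MulAction.orbit (symplecticSimilitudeInt (Fin n) K)
        ((similitudeTorusElt (uniformizer_ne_zero hϖ) (2 * (-m)) (fun _ : Fin n => -(-m)) * g :
            symplecticSimilitudeGroup (Fin n) K) : symplecticSimilitudeGroup (Fin n) K ⧸ symplecticSimilitudeInt (Fin n) K) := by
  have hϖ0 := uniformizer_ne_zero hϖ
  set Jg : symplecticSimilitudeGroup (Fin n) K := ofSymplectic ⟨Matrix.J (Fin n) K, SymplecticGroup.J_mem (Fin n) K⟩ with hJg
  set z : symplecticSimilitudeGroup (Fin n) K := similitudeTorusElt hϖ0 (2 * (-m)) (fun _ : Fin n => -(-m)) with hz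
  have hJK : Jg ∈ symplecticSimilitudeInt (Fin n) K := ofSymplectic_mem_symplecticSimilitudeInt J_mem_symplecticInt
  obtain ⟨A, hA, B, hB, hAB⟩ := (heckeAlgebra.coe_mem_orbit_coe_iff _ _ _).1 hg
  rw [MulAction.orbit_eq_iff, heckeAlgebra.coe_mem_orbit_coe_iff]
  refine ⟨B * Jg⁻¹ * A, (symplecticSimilitudeInt _ K).mul_mem ((symplecticSimilitudeInt _ K).mul_mem hB
      ((symplecticSimilitudeInt _ K).inv_mem hJK)) hA,
    B * Jg * A, (symplecticSimilitudeInt _ K).mul_mem ((symplecticSimilitudeInt _ K).mul_mem hB hJK) hA, ?_⟩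
  have e1 : g⁻¹ = B * (similitudeTorusElt hϖ0 m a)⁻¹ * A := by rw [hAB]; group
  have hzc : ∀ x : symplecticSimilitudeGroup (Fin n) K, x * z = z * x := similitudeTorusElt_two_mul_neg_central hϖ0 (-m)
  rw [e1, similitudeTorusElt_inv_eq_conj_J, ← hJg, ← hz, hAB]
  calc B * (Jg⁻¹ * (z * (A * g * B)) * Jg) * A = (B * Jg⁻¹) * z * (A * g * B * Jg * A) := by group
    _ = z * (B * Jg⁻¹) * (A * g * B * Jg * A) := by rw [hzc]
    _ = (B * Jg⁻¹ * A) * z * (g * (B * Jg * A)) := by rw [hzc (B * Jg⁻¹ * A)]; group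
    _ = B * Jg⁻¹ * A * (z * g) * (B * Jg * A) := by group

omit [NeZero n] in
/-- **`T_{g⁻¹} = T_{ϖ^{-m}·1} T_g` in `ℋ(GSp(J, K), GSp(J, 𝒪); R)`** for `g ∈ K₀ t(m, a) K₀`.
[cite: AndrianovZhuravlev1995, Ch. 3 §3 Thm. 3.7; ShimuraIATAF1971, Prop. 3.17] -/
theorem doubleCosetOperator_inv_similitude {R : Type*} [CommRing R] (hϖ : Valued.v ϖ = WithZero.exp (-1 : ℤ))
    [IsHeckeTriple (⊤ : Submonoid (symplecticSimilitudeGroup (Fin n) K)) (symplecticSimilitudeInt (Fin n) K)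
      (symplecticSimilitudeInt (Fin n) K)]
    (g : symplecticSimilitudeGroup (Fin n) K) {m : ℤ} {a : Fin n → ℤ}
    (hg : ((similitudeTorusElt (uniformizer_ne_zero hϖ) m a : symplecticSimilitudeGroup (Fin n) K) :
        symplecticSimilitudeGroup (Fin n) K ⧸ symplecticSimilitudeInt (Fin n) K) ∈
      MulAction.orbit (symplecticSimilitudeInt (Fin n) K)
        (g : symplecticSimilitudeGroup (Fin n) K ⧸ symplecticSimilitudeInt (Fin n) K)) :
    heckeAlgebra.doubleCosetOperator (k := R) (symplecticSimilitudeInt (Fin n) K) g⁻¹ =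
      heckeAlgebra.doubleCosetOperator (k := R) (symplecticSimilitudeInt (Fin n) K)
          (similitudeTorusElt (uniformizer_ne_zero hϖ) (2 * (-m)) (fun _ : Fin n => -(-m)) :
            symplecticSimilitudeGroup (Fin n) K) *
        heckeAlgebra.doubleCosetOperator (k := R) (symplecticSimilitudeInt (Fin n) K) g := by
  rw [heckeAlgebra.doubleCosetOperator_central_mul _ (similitudeTorusElt_two_mul_neg_central (uniformizer_ne_zero hϖ) (-m)),
    heckeAlgebra.doubleCosetOperator_eq_of_orbit_eq _ (orbit_inv_eq_orbit_central_mul_similitude hϖ g hg)]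

/-- The multiplier exponent of every coset in `K₀ g K₀`, `g ∈ K₀ t(m, a) K₀`, is `m`. [cite: AndrianovZhuravlev1995, Ch. 3 §3 (3.3)] -/
theorem snd_similitudeIwasawaExp_out_eq_of_mem_orbit (hϖ : Valued.v ϖ = WithZero.exp (-1 : ℤ))
    {g : symplecticSimilitudeGroup (Fin n) K} {m : ℤ} {a : Fin n → ℤ}
    (hg : ((similitudeTorusElt (uniformizer_ne_zero hϖ) m a : symplecticSimilitudeGroup (Fin n) K) :
        symplecticSimilitudeGroup (Fin n) K ⧸ symplecticSimilitudeInt (Fin n) K) ∈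
      MulAction.orbit (symplecticSimilitudeInt (Fin n) K)
        (g : symplecticSimilitudeGroup (Fin n) K ⧸ symplecticSimilitudeInt (Fin n) K))
    {γ : symplecticSimilitudeGroup (Fin n) K ⧸ symplecticSimilitudeInt (Fin n) K}
    (hγ : γ ∈ MulAction.orbit (symplecticSimilitudeInt (Fin n) K)
      (g : symplecticSimilitudeGroup (Fin n) K ⧸ symplecticSimilitudeInt (Fin n) K)) :
    (similitudeIwasawaExp hϖ γ.out).2 = m := by
  refine snd_similitudeIwasawaExp_eq_of_mem_orbit hϖ (a := a) ?_
  rw [QuotientGroup.out_eq', MulAction.orbit_eq_iff.2 hg]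
  exact hγ

end Inversion

/-! ## §3 Relative unimodularity of `B(K) ∩ (a, c)⁻¹(0)` with respect to `B(𝒪)` in `GSp(J, K)` -/

section Unimodular

variable [NeZero n]

/-- **Unit diagonal on `B(K) ∩ (a, c)⁻¹(0)`**: if `y ∈ B(K)` and `(a, c)(y) = 0` then every diagonal entry of `y` is a unit
(`v = 1`; `y_{inr i, inr i} y_{inl i, inl i} = r(y)`, `v(r(y)) = 1`). [cite: AndrianovZhuravlev1995, Ch. 3 §3 Lemma 3.11] -/
theorem v_apply_eq_one_of_similitudeIwasawaExp_eq_zero (hϖ : Valued.v ϖ = WithZero.exp (-1 : ℤ))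
    {y : symplecticSimilitudeGroup (Fin n) K} (hy : y ∈ symplecticSimilitudeBorel n K) (hay : similitudeIwasawaExp hϖ y = 0)
    (s : Fin n ⊕ Fin n) : Valued.v (((y : GL (Fin n ⊕ Fin n) K) : Matrix (Fin n ⊕ Fin n) (Fin n ⊕ Fin n) K) s s) = 1 := by
  rcases s with i | i
  · rw [v_apply_inl_eq_exp_neg_fst hϖ hy (symplecticSimilitudeInt (Fin n) K).one_mem (mul_one y).symm i, hay, Prod.fst_zero,
      Pi.zero_apply, neg_zero, WithZero.exp_zero]
  · rw [v_apply_inr_eq_exp_sub hϖ hy (symplecticSimilitudeInt (Fin n) K).one_mem (mul_one y).symm i, hay, Prod.fst_zero,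
      Prod.snd_zero, Pi.zero_apply, sub_zero, WithZero.exp_zero]

omit [NeZero n] in
/-- The estimate behind contraction: for `μ` monotone with `μ i + μ j ≤ m` for all `i, j`, and `x ∈ B(K)` with integral entries,
every entry of `t(m, μ - m·1) x t(m, μ - m·1)⁻¹` is integral. [cite: BruhatTits1972, (4.4.4) (ii)] -/
theorem v_conj_similitudeTorusElt_apply_le_one (hϖ : Valued.v ϖ = WithZero.exp (-1 : ℤ)) {m : ℤ} {μ : Fin n → ℤ}
    (hμ : Monotone μ) (hμm : ∀ i j, μ i + μ j ≤ m) {x : symplecticSimilitudeGroup (Fin n) K}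
    (hxP : x ∈ symplecticSimilitudeBorel n K)
    (hxO : ∀ s s', Valued.v (((x : GL (Fin n ⊕ Fin n) K) : Matrix (Fin n ⊕ Fin n) (Fin n ⊕ Fin n) K) s s') ≤ 1) (s s' : Fin n ⊕ Fin n) :
    Valued.v ((((similitudeTorusElt (uniformizer_ne_zero hϖ) m (fun i => μ i - m) * x *
        (similitudeTorusElt (uniformizer_ne_zero hϖ) m (fun i => μ i - m))⁻¹ : symplecticSimilitudeGroup (Fin n) K) :
          GL (Fin n ⊕ Fin n) K) : Matrix (Fin n ⊕ Fin n) (Fin n ⊕ Fin n) K) s s') ≤ 1 := by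
  rw [coe_coe_conj_similitudeTorusElt_apply]
  rcases lt_or_ge (symplecticBorelOrder n s') (symplecticBorelOrder n s) with hlt | hle
  · rw [mem_symplecticSimilitudeBorel_iff.1 hxP hlt, mul_zero, map_zero]; exact zero_le
  · rw [map_mul, v_uniformizer_zpow hϖ, ← one_mul (1 : ℤᵐ⁰)]
    refine mul_le_mul' ?_ (hxO s s')
    rw [← WithZero.exp_zero, WithZero.exp_le_exp, neg_nonpos, sub_nonneg]
    rcases s with i | i <;> rcases s' with j | j
    · simp only [symplecticBorelOrder_inl] at hle
      simp only [Sum.elim_inl]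
      have hi := i.2; have hj := j.2
      have := hμ (show j ≤ i from Fin.le_def.2 (by omega))
      omega
    · simp only [symplecticBorelOrder_inl, symplecticBorelOrder_inr] at hle
      have hi := i.2; have hj := j.2
      omega
    · simp only [Sum.elim_inr, Sum.elim_inl]
      have := hμm i j
      omega
    · simp only [symplecticBorelOrder_inr] at hle
      simp only [Sum.elim_inr]
      have := hμ (show i ≤ j from Fin.le_def.2 hle)
      omega

omit [NeZero n] in
/-- **Conjugation by an antidominant `t_λ = t(c, α - c·1)` (`α` monotone, `αᵢ + αⱼ ≤ c`) keeps `B(𝒪)` inside `GSp(J, 𝒪)`.**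
[cite: BruhatTits1972, (4.4.4) (ii)] -/
theorem conj_mem_symplecticSimilitudeInt_of_monotone (hϖ : Valued.v ϖ = WithZero.exp (-1 : ℤ)) {c : ℤ} {α : Fin n → ℤ}
    (hα : Monotone α) (hαc : ∀ i j, α i + α j ≤ c) {x : symplecticSimilitudeGroup (Fin n) K}
    (hxP : x ∈ symplecticSimilitudeBorel n K) (hxK : x ∈ symplecticSimilitudeInt (Fin n) K) :
    similitudeTorusElt (uniformizer_ne_zero hϖ) c (fun i => α i - c) * x *
        (similitudeTorusElt (uniformizer_ne_zero hϖ) c (fun i => α i - c))⁻¹ ∈ symplecticSimilitudeInt (Fin n) K := by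
  rw [mem_symplecticSimilitudeInt_iff] at hxK ⊢
  refine ⟨v_conj_similitudeTorusElt_apply_le_one hϖ hα hαc hxP hxK.1, fun s s' => ?_⟩
  rw [← Subgroup.coe_inv, show (similitudeTorusElt (uniformizer_ne_zero hϖ) c (fun i => α i - c) * x *
      (similitudeTorusElt (uniformizer_ne_zero hϖ) c (fun i => α i - c))⁻¹)⁻¹ =
    similitudeTorusElt (uniformizer_ne_zero hϖ) c (fun i => α i - c) * x⁻¹ *
      (similitudeTorusElt (uniformizer_ne_zero hϖ) c (fun i => α i - c))⁻¹ from by group]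
  refine v_conj_similitudeTorusElt_apply_le_one hϖ hα hαc ((symplecticSimilitudeBorel n K).inv_mem hxP) (fun s s' => ?_) s s'
  rw [Subgroup.coe_inv]
  exact hxK.2 s s'

omit [NeZero n] in
/-- **`t_λ B(𝒪) t_λ⁻¹ ≤ B(𝒪)` for antidominant `λ = (α, c)`** (`α` monotone, `αᵢ + αⱼ ≤ c`; `B(𝒪) = B(K) ∩ GSp(J, 𝒪)`,
`t_λ = t(c, α - c·1)`). [cite: CartierCorvallis1979, §IV (4.2)] [cite: BruhatTits1972, (4.4.4) (ii)] -/
theorem conjAct_smul_inf_le_similitude (hϖ : Valued.v ϖ = WithZero.exp (-1 : ℤ)) {c : ℤ} {α : Fin n → ℤ} (hα : Monotone α)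
    (hαc : ∀ i j, α i + α j ≤ c) :
    toConjAct (similitudeTorusElt (uniformizer_ne_zero hϖ) c (fun i => α i - c) : symplecticSimilitudeGroup (Fin n) K) •
        (symplecticSimilitudeBorel n K ⊓ symplecticSimilitudeInt (Fin n) K) ≤
      symplecticSimilitudeBorel n K ⊓ symplecticSimilitudeInt (Fin n) K := by
  set t : symplecticSimilitudeGroup (Fin n) K := similitudeTorusElt (uniformizer_ne_zero hϖ) c (fun i => α i - c) with ht
  have htP : t ∈ symplecticSimilitudeBorel n K := similitudeTorusElt_mem_symplecticSimilitudeBorel _ _ _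
  intro y hy
  rw [Subgroup.mem_pointwise_smul_iff_inv_smul_mem, ← toConjAct_inv, toConjAct_inv_smul] at hy
  obtain ⟨hyP, hyK⟩ := Subgroup.mem_inf.1 hy
  have e : y = t * (t⁻¹ * y * t) * t⁻¹ := by group
  refine Subgroup.mem_inf.2 ⟨?_, ?_⟩
  · rw [e]
    exact (symplecticSimilitudeBorel n K).mul_mem ((symplecticSimilitudeBorel n K).mul_mem htP hyP)
      ((symplecticSimilitudeBorel n K).inv_mem htP)
  · rw [e]
    exact conj_mem_symplecticSimilitudeInt_of_monotone hϖ hα hαc hyP hyK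

/-- **A power of `t₀ = t(0, (i - n)_i)` conjugates every `y ∈ B(K)` with `(a, c)(y) = 0` into `GSp(J, 𝒪)`**: the entry
`(s, s')`, `o(s) < o(s')`, of `t₀ᵏ y t₀⁻ᵏ` is `ϖ^{k(ε s - ε s')} y_{s s'}` with `ε s - ε s' ≥ 1`, the diagonal is a unit, the rest
vanishes; likewise for `y⁻¹`. [cite: CartierCorvallis1979, §IV (4.2)] -/
theorem exists_conj_pow_mem_symplecticSimilitudeInt (hϖ : Valued.v ϖ = WithZero.exp (-1 : ℤ))
    {y : symplecticSimilitudeGroup (Fin n) K} (hy : y ∈ symplecticSimilitudeBorel n K) (hay : similitudeIwasawaExp hϖ y = 0) :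
    ∃ k : ℕ, toConjAct ((similitudeTorusElt (uniformizer_ne_zero hϖ) 0 (fun i : Fin n => (i : ℤ) - n) :
        symplecticSimilitudeGroup (Fin n) K) ^ k) • y ∈ symplecticSimilitudeInt (Fin n) K := by
  have hϖ0 := uniformizer_ne_zero hϖ
  obtain ⟨k₁, hk₁⟩ := exists_forall_v_zpow_mul_apply_le_one hϖ ((y : GL (Fin n ⊕ Fin n) K) : Matrix (Fin n ⊕ Fin n) (Fin n ⊕ Fin n) K)
  obtain ⟨k₂, hk₂⟩ := exists_forall_v_zpow_mul_apply_le_one hϖ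
    (((y⁻¹ : symplecticSimilitudeGroup (Fin n) K) : GL (Fin n ⊕ Fin n) K) : Matrix (Fin n ⊕ Fin n) (Fin n ⊕ Fin n) K)
  refine ⟨max k₁ k₂, ?_⟩
  have hμ : StrictMono (fun i : Fin n => (i : ℤ) - n) := fun i j hij => by
    have : (i : ℕ) < (j : ℕ) := hij
    simp only; omega
  have hμ0 : ∀ i : Fin n, (fun i : Fin n => (i : ℤ) - n) i < 0 := fun i => by have := i.2; simp only; omega
  have hyinv : y⁻¹ ∈ symplecticSimilitudeBorel n K := (symplecticSimilitudeBorel n K).inv_mem hy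
  have hayinv : similitudeIwasawaExp hϖ y⁻¹ = 0 := by
    rw [(isIwasawaExponent_similitude hϖ).apply_inv_of_mem_left hy, hay, neg_zero]
  -- the estimate, for `y` and for `y⁻¹`
  have key : ∀ x : symplecticSimilitudeGroup (Fin n) K, x ∈ symplecticSimilitudeBorel n K → similitudeIwasawaExp hϖ x = 0 →
      (∀ s s', ∀ l : ℤ, ((max k₁ k₂ : ℕ) : ℤ) ≤ l →
        Valued.v (ϖ ^ l * ((x : GL (Fin n ⊕ Fin n) K) : Matrix (Fin n ⊕ Fin n) (Fin n ⊕ Fin n) K) s s') ≤ 1) →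
      ∀ s s', Valued.v ((((similitudeTorusElt hϖ0 (((max k₁ k₂ : ℕ) : ℤ) * 0)
          (((max k₁ k₂ : ℕ) : ℤ) • fun i : Fin n => (i : ℤ) - n) * x *
        (similitudeTorusElt hϖ0 (((max k₁ k₂ : ℕ) : ℤ) * 0) (((max k₁ k₂ : ℕ) : ℤ) • fun i : Fin n => (i : ℤ) - n))⁻¹ :
          symplecticSimilitudeGroup (Fin n) K) : GL (Fin n ⊕ Fin n) K) : Matrix (Fin n ⊕ Fin n) (Fin n ⊕ Fin n) K) s s') ≤ 1 := by
    intro x hxP hax hxO s s'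
    rw [coe_coe_conj_similitudeTorusElt_apply]
    rcases lt_trichotomy (symplecticBorelOrder n s') (symplecticBorelOrder n s) with hlt | heq | hgt
    · rw [mem_symplecticSimilitudeBorel_iff.1 hxP hlt, mul_zero, map_zero]; exact zero_le
    · have hss' : s = s' := symplecticBorelOrder_injective heq.symm
      subst hss'
      rw [sub_self, zpow_zero, one_mul, v_apply_eq_one_of_similitudeIwasawaExp_eq_zero hϖ hxP hax]
    · have h1 := one_le_elim_sub_elim_of_symplecticBorelOrder_lt hμ hμ0 hgt
      have hexp : Sum.elim (fun i => ((max k₁ k₂ : ℕ) : ℤ) * 0 + (((max k₁ k₂ : ℕ) : ℤ) • fun i : Fin n => (i : ℤ) - n) i)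
            (fun i => -(((max k₁ k₂ : ℕ) : ℤ) • fun i : Fin n => (i : ℤ) - n) i) s -
          Sum.elim (fun i => ((max k₁ k₂ : ℕ) : ℤ) * 0 + (((max k₁ k₂ : ℕ) : ℤ) • fun i : Fin n => (i : ℤ) - n) i)
            (fun i => -(((max k₁ k₂ : ℕ) : ℤ) • fun i : Fin n => (i : ℤ) - n) i) s' =
          ((max k₁ k₂ : ℕ) : ℤ) * (Sum.elim (fun i : Fin n => (i : ℤ) - n) (-fun i : Fin n => (i : ℤ) - n) s -
            Sum.elim (fun i : Fin n => (i : ℤ) - n) (-fun i : Fin n => (i : ℤ) - n) s') := by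
        rcases s with i | i <;> rcases s' with j | j <;>
          simp only [Sum.elim_inl, Sum.elim_inr, Pi.neg_apply, Pi.smul_apply, smul_eq_mul] <;> ring
      rw [hexp]
      exact hxO s s' _ (by nlinarith)
  rw [toConjAct_smul, similitudeTorusElt_pow, mem_symplecticSimilitudeInt_iff]
  refine ⟨key y hy hay fun s s' l hl => hk₁ s s' l ((Int.ofNat_le.2 (le_max_left k₁ k₂)).trans hl), fun s s' => ?_⟩
  rw [← Subgroup.coe_inv, show (similitudeTorusElt hϖ0 (((max k₁ k₂ : ℕ) : ℤ) * 0) (((max k₁ k₂ : ℕ) : ℤ) • fun i : Fin n => (i : ℤ) - n) *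
      y * (similitudeTorusElt hϖ0 (((max k₁ k₂ : ℕ) : ℤ) * 0) (((max k₁ k₂ : ℕ) : ℤ) • fun i : Fin n => (i : ℤ) - n))⁻¹)⁻¹ =
    similitudeTorusElt hϖ0 (((max k₁ k₂ : ℕ) : ℤ) * 0) (((max k₁ k₂ : ℕ) : ℤ) • fun i : Fin n => (i : ℤ) - n) * y⁻¹ *
      (similitudeTorusElt hϖ0 (((max k₁ k₂ : ℕ) : ℤ) * 0) (((max k₁ k₂ : ℕ) : ℤ) • fun i : Fin n => (i : ℤ) - n))⁻¹ from by group]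
  refine key y⁻¹ hyinv hayinv (fun s s' l hl => ?_) s s'
  exact hk₂ s s' l ((Int.ofNat_le.2 (le_max_right k₁ k₂)).trans hl)

/-- **THE RELATIVE UNIMODULARITY HYPOTHESIS FOR `GSp_{2n}`**: every `y ∈ B(K)` with `(a, c)(y) = 0` lies in a subgroup `V ⊇ B(𝒪)`
with `[V : B(𝒪)] < ∞`. [cite: CartierCorvallis1979, §I.3, §IV (4.2)] -/
theorem exists_subgroup_relIndex_ne_zero_similitude (hϖ : Valued.v ϖ = WithZero.exp (-1 : ℤ))
    [IsHeckeTriple (⊤ : Submonoid (symplecticSimilitudeGroup (Fin n) K)) (symplecticSimilitudeInt (Fin n) K)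
      (symplecticSimilitudeInt (Fin n) K)] :
    ∀ y ∈ symplecticSimilitudeBorel n K, similitudeIwasawaExp hϖ y = 0 →
      ∃ V : Subgroup (symplecticSimilitudeGroup (Fin n) K), y ∈ V ∧
        symplecticSimilitudeBorel n K ⊓ symplecticSimilitudeInt (Fin n) K ≤ V ∧
        (symplecticSimilitudeBorel n K ⊓ symplecticSimilitudeInt (Fin n) K).relIndex V ≠ 0 := by
  have hcon := conjAct_smul_inf_le_similitude (K := K) hϖ (c := 0) (α := fun i : Fin n => (i : ℤ) - n)
    (fun i j hij => by have : (i : ℕ) ≤ (j : ℕ) := hij; simp only; omega)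
    (fun i j => by have := i.2; have := j.2; omega)
  simp only [sub_zero] at hcon
  exact IsIwasawaExponent.exists_subgroup_relIndex_ne_zero_of_contracting (a := similitudeIwasawaExp hϖ)
    (similitudeTorusElt_mem_symplecticSimilitudeBorel _ _ _) hcon
    fun y hy hay => exists_conj_pow_mem_symplecticSimilitudeInt hϖ hy hay

end Unimodular

/-! ## §4 The `w₀`-symmetry of the Satake transforms of `GSp(J, K)`, `w₀(α, c) = (c·1 - α, c)` -/

section Duality

variable [NeZero n] {R : Type*} [CommRing R]
  [IsHeckeTriple (⊤ : Submonoid (symplecticSimilitudeGroup (Fin n) K)) (symplecticSimilitudeInt (Fin n) K)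
    (symplecticSimilitudeInt (Fin n) K)]

/-- **DUALITY FOR `GSp_{2n}` (counting version)**: for every `g`, every `λ = (α, c)` and `t_λ = t(c, α - c·1)`,
`#{γ ∈ K₀gK₀/K₀ : (a,c)(γ) = λ} · [t_λK_Pt_λ⁻¹ : K_P ∩ t_λK_Pt_λ⁻¹] = #{γ ∈ K₀gK₀/K₀ : (a,c)(γ) = w₀λ} · [K_P : K_P ∩ t_λK_Pt_λ⁻¹]`,
`w₀(α, c) = (c·1 - α, c)` (`K_P = B(𝒪)`; both counts vanish unless `c = c(g)`).
[cite: AndrianovZhuravlev1995, Ch. 3 §3.3 Thm. 3.30] [cite: CartierCorvallis1979, §IV (4.2), Thm. 4.1] -/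
theorem card_filter_similitudeIwasawaExp_mul_relIndex_eq (hϖ : Valued.v ϖ = WithZero.exp (-1 : ℤ))
    (g : symplecticSimilitudeGroup (Fin n) K) (α : Fin n → ℤ) (c : ℤ)
    [DecidablePred fun γ : symplecticSimilitudeGroup (Fin n) K ⧸ symplecticSimilitudeInt (Fin n) K =>
      similitudeIwasawaExp hϖ γ.out = (α, c)]
    [DecidablePred fun γ : symplecticSimilitudeGroup (Fin n) K ⧸ symplecticSimilitudeInt (Fin n) K =>
      similitudeIwasawaExp hϖ γ.out = (fun i => c - α i, c)] :
    ((finite_orbit_quotient (symplecticSimilitudeInt (Fin n) K) g).toFinset.filter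
          (fun γ => similitudeIwasawaExp hϖ γ.out = (α, c))).card *
        (symplecticSimilitudeBorel n K ⊓ symplecticSimilitudeInt (Fin n) K).relIndex
          (toConjAct (similitudeTorusElt (uniformizer_ne_zero hϖ) c (fun i => α i - c) : symplecticSimilitudeGroup (Fin n) K) •
            (symplecticSimilitudeBorel n K ⊓ symplecticSimilitudeInt (Fin n) K)) =
      ((finite_orbit_quotient (symplecticSimilitudeInt (Fin n) K) g).toFinset.filter
          (fun γ => similitudeIwasawaExp hϖ γ.out = (fun i => c - α i, c))).card *
        (toConjAct (similitudeTorusElt (uniformizer_ne_zero hϖ) c (fun i => α i - c) : symplecticSimilitudeGroup (Fin n) K) •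
            (symplecticSimilitudeBorel n K ⊓ symplecticSimilitudeInt (Fin n) K)).relIndex
          (symplecticSimilitudeBorel n K ⊓ symplecticSimilitudeInt (Fin n) K) := by
  classical
  have hϖ0 := uniformizer_ne_zero hϖ
  obtain ⟨m, a, -, -, hg⟩ := exists_dominant_similitudeTorusElt_mem_orbit hϖ
    (g : symplecticSimilitudeGroup (Fin n) K ⧸ symplecticSimilitudeInt (Fin n) K)
  have ha := similitudeIwasawaExp_similitudeTorusElt_sub (K := K) hϖ α c
  have hz := similitudeIwasawaExp_similitudeTorusElt_two_mul_neg (K := K) (n := n) hϖ (-m)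
  -- the abstract twisted duality, with `z = ϖ^{-m}·1`, `-a z - λ = (m·1 - α, 2m - c)`
  have key := (isIwasawaExponent_similitude hϖ).card_filter_mul_relIndex_eq_of_orbit_inv_eq
    (exists_subgroup_relIndex_ne_zero_similitude hϖ) (similitudeTorusElt_two_mul_neg_central hϖ0 (-m))
    (similitudeTorusElt_mem_symplecticSimilitudeBorel _ _ _) (orbit_inv_eq_orbit_central_mul_similitude hϖ g hg)
    (similitudeTorusElt_mem_symplecticSimilitudeBorel hϖ0 c (fun i => α i - c))
  have e : -similitudeIwasawaExp hϖ (similitudeTorusElt hϖ0 (2 * (-m)) (fun _ : Fin n => -(-m)) :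
        symplecticSimilitudeGroup (Fin n) K) - ((α, c) : (Fin n → ℤ) × ℤ) = (fun i => m - α i, 2 * m - c) := by
    rw [hz]
    refine Prod.ext (funext fun i => ?_) ?_
    · simp only [Prod.neg_mk, Prod.mk_sub_mk, Pi.neg_apply, Pi.sub_apply]; ring
    · simp only [Prod.neg_mk, Prod.mk_sub_mk]; ring
  simp only [ha] at key
  simp only [e] at key
  by_cases hcm : c = m
  · subst hcm
    have e2 : ((fun i => c - α i, 2 * c - c) : (Fin n → ℤ) × ℤ) = (fun i => c - α i, c) := by
      refine Prod.ext rfl ?_; simp only; ring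
    simp only [e2] at key
    convert key using 2
  · -- both counts vanish: every coset in `K₀ g K₀` has multiplier exponent `m ≠ c`
    have h0 : ∀ (ν : (Fin n → ℤ) × ℤ)
        [DecidablePred fun γ : symplecticSimilitudeGroup (Fin n) K ⧸ symplecticSimilitudeInt (Fin n) K =>
          similitudeIwasawaExp hϖ γ.out = ν], ν.2 ≠ m →
        ((finite_orbit_quotient (symplecticSimilitudeInt (Fin n) K) g).toFinset.filter
          (fun γ => similitudeIwasawaExp hϖ γ.out = ν)).card = 0 := by
      intro ν _ hν
      rw [Finset.card_eq_zero, Finset.filter_eq_empty_iff]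
      intro γ hγ hγν
      rw [Set.Finite.mem_toFinset] at hγ
      exact hν (by rw [← hγν]; exact snd_similitudeIwasawaExp_out_eq_of_mem_orbit hϖ hg hγ)
    rw [h0 (α, c) hcm, zero_mul, h0 (fun i => c - α i, c) hcm, zero_mul]

/-- **THE `w₀`-SYMMETRY OF THE SATAKE TRANSFORM OF EVERY HECKE OPERATOR ON `GSp_{2n}`**, any weight `w`: for every commutative
ring `R`, every `T ∈ ℋ(GSp(J, K), GSp(J, 𝒪); R)`, every `λ = (α, c)` (`t_λ = t(c, α - c·1)`, `w₀λ = (c·1 - α, c)`),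
`𝒮_w(T)_λ · w(w₀λ) · [t_λK_Pt_λ⁻¹ : K_P ∩ t_λK_Pt_λ⁻¹] = 𝒮_w(T)_{w₀λ} · w(λ) · [K_P : K_P ∩ t_λK_Pt_λ⁻¹]`.
[cite: AndrianovZhuravlev1995, Ch. 3 §3.3 Thm. 3.30] [cite: CartierCorvallis1979, §IV Thm. 4.1] -/
theorem coeff_satakeTransform_mul_relIndex_eq_similitude (hϖ : Valued.v ϖ = WithZero.exp (-1 : ℤ))
    (w : Multiplicative ((Fin n → ℤ) × ℤ) →* R)
    (T : heckeAlgebra R (symplecticSimilitudeGroup (Fin n) K) (symplecticSimilitudeInt (Fin n) K)) (α : Fin n → ℤ) (c : ℤ) :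
    ((isIwasawaExponent_similitude hϖ).satakeTransform w T).coeff (α, c) * w (Multiplicative.ofAdd (fun i => c - α i, c)) *
        (((symplecticSimilitudeBorel n K ⊓ symplecticSimilitudeInt (Fin n) K).relIndex
          (toConjAct (similitudeTorusElt (uniformizer_ne_zero hϖ) c (fun i => α i - c) : symplecticSimilitudeGroup (Fin n) K) •
            (symplecticSimilitudeBorel n K ⊓ symplecticSimilitudeInt (Fin n) K)) : ℕ) : R) =
      ((isIwasawaExponent_similitude hϖ).satakeTransform w T).coeff (fun i => c - α i, c) * w (Multiplicative.ofAdd (α, c)) *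
        (((toConjAct (similitudeTorusElt (uniformizer_ne_zero hϖ) c (fun i => α i - c) : symplecticSimilitudeGroup (Fin n) K) •
            (symplecticSimilitudeBorel n K ⊓ symplecticSimilitudeInt (Fin n) K)).relIndex
          (symplecticSimilitudeBorel n K ⊓ symplecticSimilitudeInt (Fin n) K) : ℕ) : R) := by
  classical
  have hT := heckeAlgebra.mem_span_range_doubleCosetOperator (symplecticSimilitudeInt (Fin n) K) T
  induction hT using Submodule.span_induction with
  | mem S hS =>
    obtain ⟨g, rfl⟩ := hS
    have hN := congrArg (Nat.cast : ℕ → R) (card_filter_similitudeIwasawaExp_mul_relIndex_eq hϖ g α c)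
    push_cast at hN
    rw [(isIwasawaExponent_similitude hϖ).coeff_satakeTransform_doubleCosetOperator,
      (isIwasawaExponent_similitude hϖ).coeff_satakeTransform_doubleCosetOperator]
    linear_combination (w (Multiplicative.ofAdd (α, c)) * w (Multiplicative.ofAdd ((fun i => c - α i, c) : (Fin n → ℤ) × ℤ))) * hN
  | zero => simp
  | add S S' _ _ hS hS' =>
    rw [map_add, AddMonoidAlgebra.coeff_add, Finsupp.add_apply, Finsupp.add_apply]
    linear_combination hS + hS'
  | smul r S _ hS =>
    rw [map_smul, AddMonoidAlgebra.coeff_smul, Finsupp.smul_apply, Finsupp.smul_apply, smul_eq_mul, smul_eq_mul]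
    linear_combination r * hS

/-- Weight `1` (the COUNTING transform): `𝒮_1(T)_λ · [t_λK_Pt_λ⁻¹ : K_P ∩ t_λK_Pt_λ⁻¹] = 𝒮_1(T)_{w₀λ} · [K_P : K_P ∩ t_λK_Pt_λ⁻¹]`.
[cite: AndrianovZhuravlev1995, Ch. 3 §3.3 Thm. 3.30] [cite: CartierCorvallis1979, §IV Thm. 4.1] -/
theorem coeff_satakeTransform_one_mul_relIndex_eq_similitude (hϖ : Valued.v ϖ = WithZero.exp (-1 : ℤ))
    (T : heckeAlgebra R (symplecticSimilitudeGroup (Fin n) K) (symplecticSimilitudeInt (Fin n) K)) (α : Fin n → ℤ) (c : ℤ) :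
    ((isIwasawaExponent_similitude hϖ).satakeTransform (1 : Multiplicative ((Fin n → ℤ) × ℤ) →* R) T).coeff (α, c) *
        (((symplecticSimilitudeBorel n K ⊓ symplecticSimilitudeInt (Fin n) K).relIndex
          (toConjAct (similitudeTorusElt (uniformizer_ne_zero hϖ) c (fun i => α i - c) : symplecticSimilitudeGroup (Fin n) K) •
            (symplecticSimilitudeBorel n K ⊓ symplecticSimilitudeInt (Fin n) K)) : ℕ) : R) =
      ((isIwasawaExponent_similitude hϖ).satakeTransform (1 : Multiplicative ((Fin n → ℤ) × ℤ) →* R) T).coeff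
          (fun i => c - α i, c) *
        (((toConjAct (similitudeTorusElt (uniformizer_ne_zero hϖ) c (fun i => α i - c) : symplecticSimilitudeGroup (Fin n) K) •
            (symplecticSimilitudeBorel n K ⊓ symplecticSimilitudeInt (Fin n) K)).relIndex
          (symplecticSimilitudeBorel n K ⊓ symplecticSimilitudeInt (Fin n) K) : ℕ) : R) := by
  have key := coeff_satakeTransform_mul_relIndex_eq_similitude (R := R) hϖ 1 T α c
  rwa [MonoidHom.one_apply, MonoidHom.one_apply, mul_one, mul_one] at key

/-- **Andrianov–Zhuravlev's / Cartier's normalisation** `𝒮_q` (weight `q^{⟨ρ, α⟩}`, `similitudeSatakeTransform`):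
`𝒮_q(T)_λ · q^{⟨ρ, c·1 - α⟩} · [t_λK_Pt_λ⁻¹ : K_P ∩ t_λK_Pt_λ⁻¹] = 𝒮_q(T)_{w₀λ} · q^{⟨ρ, α⟩} · [K_P : K_P ∩ t_λK_Pt_λ⁻¹]`.
[cite: AndrianovZhuravlev1995, Ch. 3 §3.3 (3.44)–(3.49), Thm. 3.30] [cite: CartierCorvallis1979, §IV Thm. 4.1] -/
theorem coeff_similitudeSatakeTransform_mul_relIndex_eq (hϖ : Valued.v ϖ = WithZero.exp (-1 : ℤ)) (q : Rˣ)
    (T : heckeAlgebra R (symplecticSimilitudeGroup (Fin n) K) (symplecticSimilitudeInt (Fin n) K)) (α : Fin n → ℤ) (c : ℤ) :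
    (similitudeSatakeTransform hϖ q T).coeff (α, c) * ((q ^ symplecticRhoPairing (fun i => c - α i) : Rˣ) : R) *
        (((symplecticSimilitudeBorel n K ⊓ symplecticSimilitudeInt (Fin n) K).relIndex
          (toConjAct (similitudeTorusElt (uniformizer_ne_zero hϖ) c (fun i => α i - c) : symplecticSimilitudeGroup (Fin n) K) •
            (symplecticSimilitudeBorel n K ⊓ symplecticSimilitudeInt (Fin n) K)) : ℕ) : R) =
      (similitudeSatakeTransform hϖ q T).coeff (fun i => c - α i, c) * ((q ^ symplecticRhoPairing α : Rˣ) : R) *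
        (((toConjAct (similitudeTorusElt (uniformizer_ne_zero hϖ) c (fun i => α i - c) : symplecticSimilitudeGroup (Fin n) K) •
            (symplecticSimilitudeBorel n K ⊓ symplecticSimilitudeInt (Fin n) K)).relIndex
          (symplecticSimilitudeBorel n K ⊓ symplecticSimilitudeInt (Fin n) K) : ℕ) : R) := by
  have key := coeff_satakeTransform_mul_relIndex_eq_similitude (R := R) hϖ (similitudeSatakeWeight q) T α c
  rw [similitudeSatakeWeight_ofAdd, similitudeSatakeWeight_ofAdd] at key
  rw [similitudeSatakeTransform_eq]
  exact key

/-- **Antidominant exponents**: for `α` monotone with `αᵢ + αⱼ ≤ c`, `t_λ` contracts `K_P = B(𝒪)` and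
`𝒮_1(T)_λ = 𝒮_1(T)_{w₀λ} · [K_P : t_λK_Pt_λ⁻¹]` for every `T` — the coefficient at the antidominant `x^λ` is the MODULUS
index times the coefficient at `x^{w₀λ}`. [cite: AndrianovZhuravlev1995, Ch. 3 §3.3 Thm. 3.30] [cite: Laumon1995, (4.1.4)] -/
theorem coeff_satakeTransform_one_eq_relIndex_mul_similitude (hϖ : Valued.v ϖ = WithZero.exp (-1 : ℤ))
    (T : heckeAlgebra R (symplecticSimilitudeGroup (Fin n) K) (symplecticSimilitudeInt (Fin n) K)) {α : Fin n → ℤ} {c : ℤ}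
    (hα : Monotone α) (hαc : ∀ i j, α i + α j ≤ c) :
    ((isIwasawaExponent_similitude hϖ).satakeTransform (1 : Multiplicative ((Fin n → ℤ) × ℤ) →* R) T).coeff (α, c) =
      ((isIwasawaExponent_similitude hϖ).satakeTransform (1 : Multiplicative ((Fin n → ℤ) × ℤ) →* R) T).coeff
          (fun i => c - α i, c) *
        (((toConjAct (similitudeTorusElt (uniformizer_ne_zero hϖ) c (fun i => α i - c) : symplecticSimilitudeGroup (Fin n) K) •
            (symplecticSimilitudeBorel n K ⊓ symplecticSimilitudeInt (Fin n) K)).relIndex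
          (symplecticSimilitudeBorel n K ⊓ symplecticSimilitudeInt (Fin n) K) : ℕ) : R) := by
  have h := coeff_satakeTransform_one_mul_relIndex_eq_similitude (R := R) hϖ T α c
  rwa [Subgroup.relIndex_eq_one.2 (conjAct_smul_inf_le_similitude hϖ hα hαc), Nat.cast_one, mul_one] at h

end Duality

end Literature.NumberTheory.Automorphic.SymplecticCartan

end
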